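import Literature.NumberTheory.Sieve.DrappeauDispersionS1Truncation
import Literature.NumberTheory.Sieve.DrappeauDispersionProp53
import HarnessLib

/-!
# Drappeau 2017, Theorem 5.1 from a bound for the exponential sum `ℛ₁`

Topic `Literature/NumberTheory/Sieve`, part of the formalisation of §5 of S. Drappeau, Proc. London
Math. Soc. (3) 114 (2017) 684–732 = arXiv:1504.05549 (Theorem 5.1 = the named fact
`Literature.NumberTheory.Sieve.Drappeau2017_theorem51`).  Everything here is PROVED; no definition
and no named fact is introduced.

The tree has `Drappeau2017_theorem51_of_S1` (Theorem 5.1 from the estimate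
`|𝒮₁ − A₀X₁| ≤ C M N² (log x)^c Rd^{−2}`, §5.2–5.3, §5.6), the exact Poisson identity
`𝒮₁ = A₀X₁ + (frequencies h ∉ Wℤ)` (`DrappeauDispersionS1Poisson`) and its truncation at `|h| ≤ H`
(`DrappeauDispersionS1Truncation`).  Here the dispersion-method part of §5 is closed:
`Drappeau2017.S1_of_R1` shows that the `𝒮₁`-estimate follows from the same bound for the TRUNCATED
FREQUENCY SUM

  `ℛ₁^{≤H} = ∑_{q₁,q₂} γ(q₁)γ(q₂) ∑_{n₁,n₂} β_{n₁}β̄_{n₂} (M/W) ∑_{b : b n_ja₂≡a₁ (q_j)}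
              ∑_{|h| ≤ H, h ∉ Wℤ} ψ̂(Mh/W) e(bh/W)`,   `H = ⌈(3S)² x^{ε₁}/M⌉` (any fixed `ε₁ > 0`),

the remaining frequencies contributing `O(MN²Rd^{−2})` (in fact `O(x^{−1})`) by `ψ̂`'s decay, and
`Drappeau2017_theorem51_of_R1` concludes Theorem 5.1 from such a bound.  In the paper this is the
passage "`𝒮₁(q₀,n₀) = α̂(0)X₁(q₀,n₀) + ℛ₁ + O_ε(x^εℛ₂)`", `H = W^{1+ε}M^{−1}` (arXiv p. 20); the bound
for `ℛ₁` itself is §5.4 (reduction to small `(q₀,n₀)`), (5.22)–(5.24) and the paper's Theorem 2.1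
(sums of Kloosterman sums with nebentypus), which are NOT formalised here.

## References

* S. Drappeau, Proc. London Math. Soc. (3) 114 (2017) 684–732, arXiv:1504.05549, §5.4–5.5.
  [cite: Drappeau2017, §5.4–5.5]
-/

noncomputable section

open Finset Real Complex MeasureTheory
open scoped FourierTransform ContDiff ArithmeticFunction.sigma

namespace Literature.NumberTheory.Sieve

namespace Drappeau2017

set_option maxHeartbeats 1600000 in
/-- **The `𝒮₁`-estimate from a bound for `ℛ₁^{≤H}` (core, `ε₁, η` fixed).**  Suppose that for the
given `ε₁, η > 0` there is `δ > 0` such that for every `A ≥ 0` there are `C, c, x₀` with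
`|ℛ₁^{≤H}| ≤ C M N² (log x)^c / Rd²` (`H = ⌈(3S)² x^{ε₁}/M⌉`) for all `x ≥ x₀` and all data of
Theorem 5.1 / Proposition 5.3 (`MN = x`, `x^η ≤ N ≤ S^{2/3−η}`, `x^{1/4} ≤ S ≤ x^{1/2+δ}`,
`1 ≤ Rd ≤ x^δ`, `Sx^{−δ} ≤ Y ≤ S/4`, `0 < |aᵢ| ≤ x^δ`, `|β_n| ≤ τ(n)^A`, `β` supported on squarefrees;
moduli `{1 ≤ q ≤ 2S+Y}` weighted by `γ = BFI.bump S Y`, `n ∼ N`, majorant `α = BFI.bump M (M/2)`).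
Then the hypothesis of `Drappeau2017_theorem51_of_S1` holds:
`|𝒮₁ − A₀X₁| ≤ C' M N² (log x)^{c'} / Rd²` in the same range. [cite: Drappeau2017, §5.5] -/
theorem S1_of_R1_core {ε₁ η : ℝ} (hε₁ : 0 < ε₁) (hη : 0 < η)
    (HR : ∃ δ : ℝ, 0 < δ ∧ ∀ Aτ : ℝ, 0 ≤ Aτ →
      ∃ C c₀ x₀ : ℝ, ∀ x : ℝ, x₀ ≤ x →
      ∀ M N S Rd Y : ℝ, M * N = x → x ^ η ≤ N → N ≤ S ^ (2 / 3 - η) → x ^ (1 / 4 : ℝ) ≤ S →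
        S ≤ x ^ (1 / 2 + δ) → 1 ≤ Rd → Rd ≤ x ^ δ → S * x ^ (-δ) ≤ Y → Y ≤ S / 4 →
      ∀ a₁ a₂ : ℤ, a₁ ≠ 0 → a₂ ≠ 0 → (|a₁| : ℝ) ≤ x ^ δ → (|a₂| : ℝ) ≤ x ^ δ →
      ∀ β : ℕ → ℂ, (∀ n, ‖β n‖ ≤ (σ 0 n : ℝ) ^ Aτ) → (∀ n, ¬Squarefree n → β n = 0) →
        ‖∑ q₁ ∈ ((BFI.mRange S Y).filter (fun q : ℕ => 0 < q)).filter
              (fun q : ℕ => IsCoprime (q : ℤ) (a₁ * a₂)),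
          ∑ q₂ ∈ ((BFI.mRange S Y).filter (fun q : ℕ => 0 < q)).filter
              (fun q : ℕ => IsCoprime (q : ℤ) (a₁ * a₂)),
            ((BFI.bump S Y q₁ : ℝ) : ℂ) * ((BFI.bump S Y q₂ : ℝ) : ℂ) *
            ∑ n₁ ∈ (BFI.dyadic N).filter (fun n : ℕ => IsCoprime (n : ℤ) a₂),
              ∑ n₂ ∈ (BFI.dyadic N).filter (fun n : ℕ => IsCoprime (n : ℤ) a₂),
                β n₁ * starRingEnd ℂ (β n₂) *
                ((M : ℂ) / (Nat.lcm q₁ q₂ : ℂ) *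
                  ∑ b ∈ (Finset.range (Nat.lcm q₁ q₂)).filter (fun b : ℕ =>
                      (b : ZMod q₁) * ((n₁ : ZMod q₁) * (a₂ : ZMod q₁)) = (a₁ : ZMod q₁) ∧
                      (b : ZMod q₂) * ((n₂ : ZMod q₂) * (a₂ : ZMod q₂)) = (a₁ : ZMod q₂)),
                    ∑ h ∈ Finset.Icc (-(⌈(3 * S) ^ 2 * x ^ ε₁ / M⌉₊ : ℤ)) ⌈(3 * S) ^ 2 * x ^ ε₁ / M⌉₊,
                      (if ((Nat.lcm q₁ q₂ : ℕ) : ℤ) ∣ h then 0 else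
                        𝓕 (BFI.bumpC 1 (1 / 2)) (M * h / (Nat.lcm q₁ q₂ : ℕ)) *
                          (𝐞 ((b : ℝ) * h / (Nat.lcm q₁ q₂ : ℕ)) : ℂ)))‖ ≤
          C * M * N ^ 2 * Real.log x ^ c₀ / Rd ^ 2) :
    ∃ δ : ℝ, 0 < δ ∧ ∀ Aτ : ℝ, 0 ≤ Aτ → ∃ C c₀ x₀ : ℝ, ∀ x : ℝ, x₀ ≤ x →
      ∀ M N S Rd Y : ℝ, M * N = x → x ^ η ≤ N → N ≤ S ^ (2 / 3 - η) → x ^ (1 / 4 : ℝ) ≤ S →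
        S ≤ x ^ (1 / 2 + δ) → 1 ≤ Rd → Rd ≤ x ^ δ → S * x ^ (-δ) ≤ Y → Y ≤ S / 4 →
      ∀ a₁ a₂ : ℤ, a₁ ≠ 0 → a₂ ≠ 0 → (|a₁| : ℝ) ≤ x ^ δ → (|a₂| : ℝ) ≤ x ^ δ →
      ∀ β : ℕ → ℂ, (∀ n, ‖β n‖ ≤ (σ 0 n : ℝ) ^ Aτ) → (∀ n, ¬Squarefree n → β n = 0) →
        ‖dispS1 a₁ a₂ ((BFI.mRange S Y).filter (fun q : ℕ => 0 < q)) (BFI.mRange M (M / 2))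
              (BFI.dyadic N) (fun q : ℕ => BFI.bump S Y q) (fun m : ℕ => BFI.bump M (M / 2) m) β -
            ((∑ m ∈ BFI.mRange M (M / 2), BFI.bump M (M / 2) m : ℝ) : ℂ) *
              mainX1 a₁ a₂ ((BFI.mRange S Y).filter (fun q : ℕ => 0 < q)) (BFI.dyadic N)
                (fun q : ℕ => BFI.bump S Y q) β‖ ≤
          C * M * N ^ 2 * Real.log x ^ c₀ / Rd ^ 2 := by
  obtain ⟨δ₁, hδ₁, Hδ⟩ := HR
  set δ : ℝ := min δ₁ (1 / 100) with hδdef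
  have hδ0 : 0 < δ := lt_min hδ₁ (by norm_num)
  have hδ₁' : δ ≤ δ₁ := min_le_left _ _
  have hδ1 : δ ≤ 1 / 100 := min_le_right _ _
  refine ⟨δ, hδ0, fun Aτ hAτ => ?_⟩
  obtain ⟨C₁, c₁, x₁, HC1⟩ := Hδ Aτ hAτ
  -- the number of integrations by parts: `ε₁ (n₀ - 1) ≥ 4`
  obtain ⟨n₀, hn₀2, hn₀ε⟩ : ∃ n : ℕ, 2 ≤ n ∧ 4 ≤ ε₁ * ((n : ℝ) - 1) := by
    refine ⟨⌈4 / ε₁⌉₊ + 2, by omega, ?_⟩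
    have h1 : 4 / ε₁ ≤ ⌈4 / ε₁⌉₊ := Nat.le_ceil _
    have h2 : ((⌈4 / ε₁⌉₊ + 2 : ℕ) : ℝ) - 1 = (⌈4 / ε₁⌉₊ : ℝ) + 1 := by push_cast; ring
    rw [h2]
    have h3 : 4 = ε₁ * (4 / ε₁) := by field_simp
    nlinarith
  have hK0 : 0 ≤ BFI.derivConst n₀ := zero_le_one.trans (BFI.one_le_derivConst n₀)
  set In : ℝ := ∫ t, ‖iteratedDeriv n₀ (BFI.bumpC 1 (1 / 2)) t‖ with hIndef
  have hIn0 : 0 ≤ In := integral_nonneg fun _ => norm_nonneg _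
  have hInle : In ≤ 2 ^ (n₀ + 1) * BFI.derivConst n₀ :=
    integral_norm_iteratedDeriv_bumpC_one_half_le (by omega)
  -- divisor moments
  set r : ℕ := ⌈2 * Aτ⌉₊ with hrdef
  have hr : 2 * Aτ ≤ r := Nat.le_ceil _
  have hrA : Aτ ≤ r := by linarith
  obtain ⟨Cd, hCd, hCdle⟩ := exists_sum_sigma_zero_pow_le_real r
  set cd : ℕ := 2 ^ (r + 1) with hcddef
  set CB : ℝ := Cd * 2 ^ (cd + 1) with hCBdef
  have hCB0 : 0 < CB := by positivity
  -- absorption: `32 CB² In · x^{2/100 + 2cd·(log)} ≤ x^{1/2}`; we use `L ≤ x` crudely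
  obtain ⟨x₂, hx₂⟩ := exists_mul_log_pow_le_rpow (32 * CB ^ 2 * (2 ^ (n₀ + 1) * BFI.derivConst n₀))
    (2 * cd) (κ := 12 / 25) (by norm_num)
  refine ⟨max C₁ 0 + 1, max c₁ 0, max (max x₁ 9) x₂, fun x hx M N S Rd Y hMN hN hNS hS hSx hRd1 hRd
    hY1 hY4 a₁ a₂ ha₁ ha₂ ha₁x ha₂x β hβ hβs => ?_⟩
  -- ### sizes
  have hxx₁ : x₁ ≤ x := le_trans (le_trans (le_max_left _ _) (le_max_left _ _)) hx
  have hx9 : 9 ≤ x := le_trans (le_trans (le_max_right _ _) (le_max_left _ _)) hx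
  have hxx₂ : x₂ ≤ x := le_trans (le_max_right _ _) hx
  have hx1 : 1 ≤ x := by linarith
  have hx0 : 0 < x := by linarith
  set L : ℝ := Real.log x with hLdef
  have hL1 : 1 ≤ L := by
    rw [hLdef, Real.le_log_iff_exp_le (by linarith)]
    have := Real.exp_one_lt_d9
    linarith
  have hL0 : 0 < L := by linarith
  have hLx : L ≤ x := (Real.log_le_sub_one_of_pos hx0).trans (by linarith)
  have hlog3 : Real.log 3 ≤ L := Real.log_le_log (by norm_num) (by linarith)
  have hlog2x : ∀ y : ℝ, 0 < y → y ≤ 3 * x → Real.log y ≤ 2 * L := by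
    intro y hy hyx
    calc Real.log y ≤ Real.log (3 * x) := Real.log_le_log hy hyx
      _ = Real.log 3 + Real.log x := Real.log_mul (by norm_num) hx0.ne'
      _ ≤ 2 * L := by rw [hLdef] at hlog3 ⊢; linarith
  have hN0 : 0 < N := lt_of_lt_of_le (Real.rpow_pos_of_pos hx0 η) hN
  have hM0 : 0 < M := by
    by_contra h
    have : M * N ≤ 0 := mul_nonpos_of_nonpos_of_nonneg (not_lt.1 h) hN0.le
    linarith
  have hS0 : 0 < S := lt_of_lt_of_le (Real.rpow_pos_of_pos hx0 _) hS
  have hS1 : 1 ≤ S := le_trans (Real.one_le_rpow hx1 (by norm_num)) hS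
  have hRd0 : 0 < Rd := by linarith
  have hY0 : 0 < Y := lt_of_lt_of_le (mul_pos hS0 (Real.rpow_pos_of_pos hx0 _)) hY1
  have hYS : Y ≤ S := by linarith
  have hmono : ∀ {u v : ℝ}, u ≤ v → x ^ u ≤ x ^ v := fun h => Real.rpow_le_rpow_of_exponent_le hx1 h
  have hle1 : ∀ {u : ℝ}, u ≤ 1 → x ^ u ≤ x := fun h => (hmono h).trans_eq (Real.rpow_one x)
  have hN1 : 1 ≤ N := le_trans (Real.one_le_rpow hx1 hη.le) hN
  have hSx1 : S ≤ x := hSx.trans (hle1 (by linarith))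
  have hNS23 : N ≤ S ^ (2 / 3 : ℝ) :=
    hNS.trans (Real.rpow_le_rpow_of_exponent_le hS1 (by linarith))
  have hNx34 : N ≤ x ^ (17 / 50 : ℝ) := by
    refine hNS23.trans ?_
    calc S ^ (2 / 3 : ℝ) ≤ (x ^ (1 / 2 + δ)) ^ (2 / 3 : ℝ) := Real.rpow_le_rpow hS0.le hSx (by norm_num)
      _ = x ^ ((1 / 2 + δ) * (2 / 3)) := by rw [← Real.rpow_mul hx0.le]
      _ ≤ x ^ (17 / 50 : ℝ) := hmono (by linarith)
  have hNx : N ≤ x := hNx34.trans (hle1 (by norm_num))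
  have hMhalf : x ^ (1 / 2 : ℝ) ≤ M := by
    have hMeq : M = x / N := by field_simp; linarith
    rw [hMeq, le_div_iff₀ hN0]
    calc x ^ (1 / 2 : ℝ) * N ≤ x ^ (1 / 2 : ℝ) * x ^ (17 / 50 : ℝ) :=
          mul_le_mul_of_nonneg_left hNx34 (by positivity)
      _ = x ^ (21 / 25 : ℝ) := by rw [← Real.rpow_add hx0]; norm_num
      _ ≤ x := hle1 (by norm_num)
  have hRd100 : Rd ≤ x ^ (1 / 100 : ℝ) := hRd.trans (hmono hδ1)
  -- ### the objects
  set H : ℕ := ⌈(3 * S) ^ 2 * x ^ ε₁ / M⌉₊ with hHdef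
  have hHpos : 0 < (3 * S) ^ 2 * x ^ ε₁ / M := by positivity
  have hH1 : 1 ≤ H := Nat.one_le_iff_ne_zero.2 (Nat.ceil_pos.2 hHpos).ne'
  have hHle : (3 * S) ^ 2 * x ^ ε₁ / M ≤ H := Nat.le_ceil _
  have h𝒬pos : ∀ q ∈ (BFI.mRange S Y).filter (fun q : ℕ => 0 < q), 0 < q :=
    fun q hq => (Finset.mem_filter.1 hq).2
  set L₀ : ℕ := ⌊2 * S + Y⌋₊ with hL₀def
  have hL₀le : (L₀ : ℝ) ≤ 2 * S + Y := Nat.floor_le (by linarith)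
  have hL₀3S : (L₀ : ℝ) ≤ 3 * S := by linarith
  have h𝒬sub : (BFI.mRange S Y).filter (fun q : ℕ => 0 < q) ⊆ Icc 1 L₀ := by
    intro q hq
    rw [Finset.mem_filter, BFI.mem_mRange] at hq
    rw [Finset.mem_Icc]; exact ⟨hq.2, hq.1⟩
  have h𝒬fsub : ((BFI.mRange S Y).filter (fun q : ℕ => 0 < q)).filter
      (fun q : ℕ => IsCoprime (q : ℤ) (a₁ * a₂)) ⊆ Icc 1 L₀ := (Finset.filter_subset _ _).trans h𝒬sub
  have hcard𝒬 : ((((BFI.mRange S Y).filter (fun q : ℕ => 0 < q)).filter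
      (fun q : ℕ => IsCoprime (q : ℤ) (a₁ * a₂))).card : ℝ) ≤ 3 * S := by
    calc _ ≤ ((Icc 1 L₀).card : ℝ) := by exact_mod_cast Finset.card_le_card h𝒬fsub
      _ = L₀ := by simp
      _ ≤ 3 * S := hL₀3S
  have hγabs : ∀ q : ℕ, |BFI.bump S Y q| ≤ 1 := fun q => BFI.abs_bump_le_one hY0 hS0.le _
  -- ### divisor moment for `β`
  set Bs : ℝ := ∑ n ∈ Icc 1 ⌊2 * N⌋₊, (σ 0 n : ℝ) ^ r with hBsdef
  have hBs : Bs ≤ CB * N * L ^ cd := by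
    have h := hCdle (2 * N) (by linarith)
    have hlog : Real.log (2 * N) ≤ 2 * L := hlog2x _ (by linarith) (by linarith)
    have hlog0 : 0 ≤ Real.log (2 * N) := Real.log_nonneg (by linarith)
    calc Bs ≤ Cd * (2 * N) * Real.log (2 * N) ^ cd := h
      _ ≤ Cd * (2 * N) * (2 * L) ^ cd := by gcongr
      _ = CB * N * L ^ cd := by rw [hCBdef, mul_pow, pow_succ]; ring
  have hβ1 : ∑ n ∈ (BFI.dyadic N).filter (fun n : ℕ => IsCoprime (n : ℤ) a₂), ‖β n‖ ≤ Bs :=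
    sum_filter_dyadic_norm_le hN0 hrA hβ _
  have hβ10 : 0 ≤ ∑ n ∈ (BFI.dyadic N).filter (fun n : ℕ => IsCoprime (n : ℤ) a₂), ‖β n‖ :=
    Finset.sum_nonneg fun _ _ => norm_nonneg _
  have hBf : (∑ n ∈ (BFI.dyadic N).filter (fun n : ℕ => IsCoprime (n : ℤ) a₂), ‖β n‖) ^ 2 ≤
      (CB * N * L ^ cd) ^ 2 := pow_le_pow_left₀ hβ10 (hβ1.trans hBs) 2
  -- ### the truncation error, per pair of moduli
  have hpair : ∀ q₁ ∈ ((BFI.mRange S Y).filter (fun q : ℕ => 0 < q)).filter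
        (fun q : ℕ => IsCoprime (q : ℤ) (a₁ * a₂)),
      ∀ q₂ ∈ ((BFI.mRange S Y).filter (fun q : ℕ => 0 < q)).filter
        (fun q : ℕ => IsCoprime (q : ℤ) (a₁ * a₂)),
        M / (Nat.lcm q₁ q₂ : ℝ) * (2 * In * ((Nat.lcm q₁ q₂ : ℝ) / (2 * π * M)) ^ n₀ *
          (((H : ℝ) ^ (n₀ - 1)))⁻¹) ≤ 2 * In * x ^ (-4 : ℝ) := by
    intro q₁ hq₁ q₂ hq₂
    have hq₁' := Finset.mem_Icc.1 (h𝒬fsub hq₁)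
    have hq₂' := Finset.mem_Icc.1 (h𝒬fsub hq₂)
    set W : ℕ := Nat.lcm q₁ q₂ with hWdef
    have hW : 0 < W := Nat.lcm_pos hq₁'.1 hq₂'.1
    have hWr : (0 : ℝ) < W := by exact_mod_cast hW
    have hW9 : (W : ℝ) ≤ (3 * S) ^ 2 := by
      have h1 : (W : ℝ) ≤ (q₁ : ℝ) * q₂ := by
        exact_mod_cast Nat.le_of_dvd (Nat.mul_pos hq₁'.1 hq₂'.1) (Nat.lcm_dvd_mul q₁ q₂)
      have h2 : (q₁ : ℝ) * q₂ ≤ (3 * S) * (3 * S) :=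
        mul_le_mul (le_trans (by exact_mod_cast hq₁'.2) hL₀3S)
          (le_trans (by exact_mod_cast hq₂'.2) hL₀3S) (Nat.cast_nonneg _) (by positivity)
      nlinarith
    -- `(W/M) x^{ε₁} ≤ H`
    have hWH : (W : ℝ) / M * x ^ ε₁ ≤ H := by
      refine le_trans ?_ hHle
      rw [div_mul_eq_mul_div]
      exact div_le_div_of_nonneg_right (mul_le_mul_of_nonneg_right hW9 (by positivity)) hM0.le
    have hD0 : 0 < (W : ℝ) / M := div_pos hWr hM0
    -- `(M/W)(W/(2πM))^n₀ ≤ (W/M)^{n₀-1}`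
    have hπ : (1 : ℝ) ≤ 2 * π := by have := Real.pi_gt_three; linarith
    have h1 : M / (W : ℝ) * ((W : ℝ) / (2 * π * M)) ^ n₀ ≤ ((W : ℝ) / M) ^ (n₀ - 1) := by
      have e : ((W : ℝ) / (2 * π * M)) ^ n₀ = ((W : ℝ) / M) ^ n₀ * ((2 * π) ^ n₀)⁻¹ := by
        rw [show (W : ℝ) / (2 * π * M) = ((W : ℝ) / M) * (2 * π)⁻¹ by field_simp, mul_pow, inv_pow]
      rw [e]
      have h2 : ((2 * π) ^ n₀ : ℝ)⁻¹ ≤ 1 := inv_le_one_of_one_le₀ (one_le_pow₀ hπ)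
      have h3 : M / (W : ℝ) * ((W : ℝ) / M) ^ n₀ = ((W : ℝ) / M) ^ (n₀ - 1) := by
        obtain ⟨k, hk⟩ : ∃ k, n₀ = k + 1 := ⟨n₀ - 1, by omega⟩
        rw [hk, pow_succ, Nat.add_sub_cancel]
        field_simp
      calc M / (W : ℝ) * (((W : ℝ) / M) ^ n₀ * ((2 * π) ^ n₀)⁻¹)
          = (M / (W : ℝ) * ((W : ℝ) / M) ^ n₀) * ((2 * π) ^ n₀)⁻¹ := by ring
        _ ≤ (M / (W : ℝ) * ((W : ℝ) / M) ^ n₀) * 1 :=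
            mul_le_mul_of_nonneg_left h2 (by positivity)
        _ = ((W : ℝ) / M) ^ (n₀ - 1) := by rw [mul_one, h3]
    -- `(W/M)^{n₀-1} / H^{n₀-1} ≤ x^{-ε₁ (n₀-1)} ≤ x^{-4}`
    have h2 : ((W : ℝ) / M) ^ (n₀ - 1) * (((H : ℝ) ^ (n₀ - 1)))⁻¹ ≤ x ^ (-4 : ℝ) := by
      have hHr : (0 : ℝ) < H := by exact_mod_cast hH1
      have hA : ((W : ℝ) / M) ^ (n₀ - 1) ≤ (H : ℝ) ^ (n₀ - 1) * x ^ (-4 : ℝ) := by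
        calc ((W : ℝ) / M) ^ (n₀ - 1) = (((W : ℝ) / M * x ^ ε₁) * x ^ (-ε₁)) ^ (n₀ - 1) := by
              congr 1
              rw [mul_assoc, ← Real.rpow_add hx0, add_neg_cancel, Real.rpow_zero, mul_one]
          _ = ((W : ℝ) / M * x ^ ε₁) ^ (n₀ - 1) * (x ^ (-ε₁)) ^ (n₀ - 1) := mul_pow _ _ _
          _ ≤ (H : ℝ) ^ (n₀ - 1) * (x ^ (-ε₁)) ^ (n₀ - 1) :=
              mul_le_mul_of_nonneg_right (pow_le_pow_left₀ (by positivity) hWH _) (by positivity)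
          _ ≤ (H : ℝ) ^ (n₀ - 1) * x ^ (-4 : ℝ) := by
              refine mul_le_mul_of_nonneg_left ?_ (by positivity)
              rw [← Real.rpow_natCast, ← Real.rpow_mul hx0.le, Nat.cast_sub (by omega), Nat.cast_one]
              refine Real.rpow_le_rpow_of_exponent_le hx1 ?_
              linarith
      calc ((W : ℝ) / M) ^ (n₀ - 1) * (((H : ℝ) ^ (n₀ - 1)))⁻¹
          ≤ ((H : ℝ) ^ (n₀ - 1) * x ^ (-4 : ℝ)) * (((H : ℝ) ^ (n₀ - 1)))⁻¹ :=
            mul_le_mul_of_nonneg_right hA (by positivity)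
        _ = x ^ (-4 : ℝ) := by field_simp
    calc M / (W : ℝ) * (2 * In * ((W : ℝ) / (2 * π * M)) ^ n₀ * (((H : ℝ) ^ (n₀ - 1)))⁻¹)
        = 2 * In * ((M / (W : ℝ) * ((W : ℝ) / (2 * π * M)) ^ n₀) * (((H : ℝ) ^ (n₀ - 1)))⁻¹) := by
          ring
      _ ≤ 2 * In * (((W : ℝ) / M) ^ (n₀ - 1) * (((H : ℝ) ^ (n₀ - 1)))⁻¹) := by
          refine mul_le_mul_of_nonneg_left (mul_le_mul_of_nonneg_right h1 (by positivity)) (by positivity)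
      _ ≤ 2 * In * x ^ (-4 : ℝ) := mul_le_mul_of_nonneg_left h2 (by positivity)
  -- ### the truncation error in total
  have htrunc := norm_dispS1_sub_mainX1_sub_freqTrunc_le a₁ a₂ h𝒬pos (BFI.dyadic N)
    (fun q : ℕ => BFI.bump S Y q) β hM0 hH1 hn₀2
  have htot : ∑ q₁ ∈ ((BFI.mRange S Y).filter (fun q : ℕ => 0 < q)).filter
        (fun q : ℕ => IsCoprime (q : ℤ) (a₁ * a₂)),
      ∑ q₂ ∈ ((BFI.mRange S Y).filter (fun q : ℕ => 0 < q)).filter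
        (fun q : ℕ => IsCoprime (q : ℤ) (a₁ * a₂)), |BFI.bump S Y q₁ * BFI.bump S Y q₂| *
        ((∑ n ∈ (BFI.dyadic N).filter (fun n : ℕ => IsCoprime (n : ℤ) a₂), ‖β n‖) ^ 2 *
          (M / (Nat.lcm q₁ q₂ : ℝ) * (2 * In * ((Nat.lcm q₁ q₂ : ℝ) / (2 * π * M)) ^ n₀ *
            (((H : ℝ) ^ (n₀ - 1)))⁻¹))) ≤ M * N ^ 2 / Rd ^ 2 := by
    have hterm : ∀ q₁ ∈ ((BFI.mRange S Y).filter (fun q : ℕ => 0 < q)).filter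
          (fun q : ℕ => IsCoprime (q : ℤ) (a₁ * a₂)),
        ∀ q₂ ∈ ((BFI.mRange S Y).filter (fun q : ℕ => 0 < q)).filter
          (fun q : ℕ => IsCoprime (q : ℤ) (a₁ * a₂)), |BFI.bump S Y q₁ * BFI.bump S Y q₂| *
          ((∑ n ∈ (BFI.dyadic N).filter (fun n : ℕ => IsCoprime (n : ℤ) a₂), ‖β n‖) ^ 2 *
            (M / (Nat.lcm q₁ q₂ : ℝ) * (2 * In * ((Nat.lcm q₁ q₂ : ℝ) / (2 * π * M)) ^ n₀ *
              (((H : ℝ) ^ (n₀ - 1)))⁻¹))) ≤ (CB * N * L ^ cd) ^ 2 * (2 * In * x ^ (-4 : ℝ)) := by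
      intro q₁ hq₁ q₂ hq₂
      have hγ1 : |BFI.bump S Y q₁ * BFI.bump S Y q₂| ≤ 1 := by
        rw [abs_mul]; exact mul_le_one₀ (hγabs q₁) (abs_nonneg _) (hγabs q₂)
      calc _ ≤ 1 * ((CB * N * L ^ cd) ^ 2 * (2 * In * x ^ (-4 : ℝ))) := by
            refine mul_le_mul hγ1 (mul_le_mul hBf (hpair q₁ hq₁ q₂ hq₂) (by positivity)
              (by positivity)) (by positivity) zero_le_one
        _ = _ := one_mul _
    refine (Finset.sum_le_sum fun q₁ hq₁ => Finset.sum_le_sum fun q₂ hq₂ => hterm q₁ hq₁ q₂ hq₂).trans ?_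
    rw [Finset.sum_const, Finset.sum_const, nsmul_eq_mul, nsmul_eq_mul]
    -- `(3S)² (CB N L^cd)² 2 In x^{-4} ≤ M N² / Rd²`
    have hIn' : In ≤ 2 ^ (n₀ + 1) * BFI.derivConst n₀ := hInle
    have habs : 32 * CB ^ 2 * (2 ^ (n₀ + 1) * BFI.derivConst n₀) * L ^ (2 * cd) ≤ x ^ (12 / 25 : ℝ) :=
      hx₂ x hxx₂
    have hRd2 : Rd ^ 2 ≤ x ^ (1 / 50 : ℝ) := by
      calc Rd ^ 2 ≤ (x ^ (1 / 100 : ℝ)) ^ 2 := pow_le_pow_left₀ hRd0.le hRd100 2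
        _ = x ^ (1 / 50 : ℝ) := by rw [← Real.rpow_natCast, ← Real.rpow_mul hx0.le]; norm_num
    rw [le_div_iff₀ (by positivity)]
    calc (((((BFI.mRange S Y).filter (fun q : ℕ => 0 < q)).filter
          (fun q : ℕ => IsCoprime (q : ℤ) (a₁ * a₂))).card : ℝ)) *
          (((((BFI.mRange S Y).filter (fun q : ℕ => 0 < q)).filter
            (fun q : ℕ => IsCoprime (q : ℤ) (a₁ * a₂))).card : ℝ) *
            ((CB * N * L ^ cd) ^ 2 * (2 * In * x ^ (-4 : ℝ)))) * Rd ^ 2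
        ≤ (3 * S) * ((3 * S) * ((CB * N * L ^ cd) ^ 2 *
            (2 * (2 ^ (n₀ + 1) * BFI.derivConst n₀) * x ^ (-4 : ℝ)))) * x ^ (1 / 50 : ℝ) := by
          gcongr
      _ = (9 / 16) * (32 * CB ^ 2 * (2 ^ (n₀ + 1) * BFI.derivConst n₀) * L ^ (2 * cd)) *
            (S ^ 2 * x ^ (-4 : ℝ) * x ^ (1 / 50 : ℝ)) * N ^ 2 := by ring
      _ ≤ 1 * x ^ (12 / 25 : ℝ) * (x ^ 2 * x ^ (-4 : ℝ) * x ^ (1 / 50 : ℝ)) * N ^ 2 := by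
          gcongr
          · norm_num
      _ = x ^ (-(3 / 2) : ℝ) * N ^ 2 := by
          rw [one_mul, show x ^ (2 : ℕ) = x ^ (2 : ℝ) by rw [← Real.rpow_natCast]; norm_num,
            ← Real.rpow_add hx0, ← Real.rpow_add hx0, ← Real.rpow_add hx0]
          norm_num
      _ ≤ M * N ^ 2 := by
          refine mul_le_mul_of_nonneg_right ?_ (by positivity)
          exact ((hmono (by norm_num)).trans hMhalf)
  -- ### the hypothesis and the conclusion
  have hR1 := HC1 x hxx₁ M N S Rd Y hMN hN hNS hS (hSx.trans (hmono (by linarith))) hRd1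
    (hRd.trans (hmono hδ₁')) (le_trans (mul_le_mul_of_nonneg_left
      (Real.rpow_le_rpow_of_exponent_le hx1 (by linarith)) hS0.le) hY1)
    hY4 a₁ a₂ ha₁ ha₂ (ha₁x.trans (hmono hδ₁')) (ha₂x.trans (hmono hδ₁')) β hβ hβs
  have hmain := (norm_le_norm_add_norm_sub' _ _).trans (add_le_add hR1 (htrunc.trans htot))
  refine hmain.trans ?_
  -- `C₁ M N² L^{c₁}/Rd² + M N²/Rd² ≤ (max C₁ 0 + 1) M N² L^{max c₁ 0}/Rd²`
  have hLc : L ^ c₁ ≤ L ^ max c₁ 0 := Real.rpow_le_rpow_of_exponent_le hL1 (le_max_left _ _)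
  have hLc1 : 1 ≤ L ^ max c₁ 0 := Real.one_le_rpow hL1 (le_max_right _ _)
  have h0 : 0 ≤ max C₁ 0 := le_max_right _ _
  have hbase : 0 ≤ M * N ^ 2 / Rd ^ 2 := by positivity
  have e1 : C₁ * M * N ^ 2 * L ^ c₁ / Rd ^ 2 ≤ max C₁ 0 * (M * N ^ 2 * L ^ max c₁ 0 / Rd ^ 2) := by
    calc C₁ * M * N ^ 2 * L ^ c₁ / Rd ^ 2 ≤ max C₁ 0 * M * N ^ 2 * L ^ c₁ / Rd ^ 2 := by
          gcongr; exact le_max_left _ _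
      _ = max C₁ 0 * (M * N ^ 2 / Rd ^ 2) * L ^ c₁ := by ring
      _ ≤ max C₁ 0 * (M * N ^ 2 / Rd ^ 2) * L ^ max c₁ 0 :=
          mul_le_mul_of_nonneg_left hLc (mul_nonneg h0 hbase)
      _ = _ := by ring
  have e2 : M * N ^ 2 / Rd ^ 2 ≤ M * N ^ 2 * L ^ max c₁ 0 / Rd ^ 2 := by
    calc M * N ^ 2 / Rd ^ 2 = (M * N ^ 2 / Rd ^ 2) * 1 := (mul_one _).symm
      _ ≤ (M * N ^ 2 / Rd ^ 2) * L ^ max c₁ 0 := mul_le_mul_of_nonneg_left hLc1 hbase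
      _ = _ := by ring
  calc C₁ * M * N ^ 2 * Real.log x ^ c₁ / Rd ^ 2 + M * N ^ 2 / Rd ^ 2
      ≤ max C₁ 0 * (M * N ^ 2 * L ^ max c₁ 0 / Rd ^ 2) + M * N ^ 2 * L ^ max c₁ 0 / Rd ^ 2 :=
        add_le_add e1 e2
    _ = (max C₁ 0 + 1) * M * N ^ 2 * L ^ max c₁ 0 / Rd ^ 2 := by ring


/-- **The `𝒮₁`-estimate from a bound for `ℛ₁^{≤H}`** (uniform `ε₁`; kept for the record — the
paper's argument gives `ε₁` depending on `η`, see `S1_of_R1'`). [cite: Drappeau2017, §5.5] -/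
theorem S1_of_R1
    (HR1 : ∃ ε₁ : ℝ, 0 < ε₁ ∧ ∀ η : ℝ, 0 < η → ∃ δ : ℝ, 0 < δ ∧ ∀ Aτ : ℝ, 0 ≤ Aτ →
      ∃ C c₀ x₀ : ℝ, ∀ x : ℝ, x₀ ≤ x →
      ∀ M N S Rd Y : ℝ, M * N = x → x ^ η ≤ N → N ≤ S ^ (2 / 3 - η) → x ^ (1 / 4 : ℝ) ≤ S →
        S ≤ x ^ (1 / 2 + δ) → 1 ≤ Rd → Rd ≤ x ^ δ → S * x ^ (-δ) ≤ Y → Y ≤ S / 4 →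
      ∀ a₁ a₂ : ℤ, a₁ ≠ 0 → a₂ ≠ 0 → (|a₁| : ℝ) ≤ x ^ δ → (|a₂| : ℝ) ≤ x ^ δ →
      ∀ β : ℕ → ℂ, (∀ n, ‖β n‖ ≤ (σ 0 n : ℝ) ^ Aτ) → (∀ n, ¬Squarefree n → β n = 0) →
        ‖∑ q₁ ∈ ((BFI.mRange S Y).filter (fun q : ℕ => 0 < q)).filter
              (fun q : ℕ => IsCoprime (q : ℤ) (a₁ * a₂)),
          ∑ q₂ ∈ ((BFI.mRange S Y).filter (fun q : ℕ => 0 < q)).filter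
              (fun q : ℕ => IsCoprime (q : ℤ) (a₁ * a₂)),
            ((BFI.bump S Y q₁ : ℝ) : ℂ) * ((BFI.bump S Y q₂ : ℝ) : ℂ) *
            ∑ n₁ ∈ (BFI.dyadic N).filter (fun n : ℕ => IsCoprime (n : ℤ) a₂),
              ∑ n₂ ∈ (BFI.dyadic N).filter (fun n : ℕ => IsCoprime (n : ℤ) a₂),
                β n₁ * starRingEnd ℂ (β n₂) *
                ((M : ℂ) / (Nat.lcm q₁ q₂ : ℂ) *
                  ∑ b ∈ (Finset.range (Nat.lcm q₁ q₂)).filter (fun b : ℕ =>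
                      (b : ZMod q₁) * ((n₁ : ZMod q₁) * (a₂ : ZMod q₁)) = (a₁ : ZMod q₁) ∧
                      (b : ZMod q₂) * ((n₂ : ZMod q₂) * (a₂ : ZMod q₂)) = (a₁ : ZMod q₂)),
                    ∑ h ∈ Finset.Icc (-(⌈(3 * S) ^ 2 * x ^ ε₁ / M⌉₊ : ℤ)) ⌈(3 * S) ^ 2 * x ^ ε₁ / M⌉₊,
                      (if ((Nat.lcm q₁ q₂ : ℕ) : ℤ) ∣ h then 0 else
                        𝓕 (BFI.bumpC 1 (1 / 2)) (M * h / (Nat.lcm q₁ q₂ : ℕ)) *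
                          (𝐞 ((b : ℝ) * h / (Nat.lcm q₁ q₂ : ℕ)) : ℂ)))‖ ≤
          C * M * N ^ 2 * Real.log x ^ c₀ / Rd ^ 2) :
    ∀ η : ℝ, 0 < η → ∃ δ : ℝ, 0 < δ ∧ ∀ Aτ : ℝ, 0 ≤ Aτ → ∃ C c₀ x₀ : ℝ, ∀ x : ℝ, x₀ ≤ x →
      ∀ M N S Rd Y : ℝ, M * N = x → x ^ η ≤ N → N ≤ S ^ (2 / 3 - η) → x ^ (1 / 4 : ℝ) ≤ S →
        S ≤ x ^ (1 / 2 + δ) → 1 ≤ Rd → Rd ≤ x ^ δ → S * x ^ (-δ) ≤ Y → Y ≤ S / 4 →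
      ∀ a₁ a₂ : ℤ, a₁ ≠ 0 → a₂ ≠ 0 → (|a₁| : ℝ) ≤ x ^ δ → (|a₂| : ℝ) ≤ x ^ δ →
      ∀ β : ℕ → ℂ, (∀ n, ‖β n‖ ≤ (σ 0 n : ℝ) ^ Aτ) → (∀ n, ¬Squarefree n → β n = 0) →
        ‖dispS1 a₁ a₂ ((BFI.mRange S Y).filter (fun q : ℕ => 0 < q)) (BFI.mRange M (M / 2))
              (BFI.dyadic N) (fun q : ℕ => BFI.bump S Y q) (fun m : ℕ => BFI.bump M (M / 2) m) β -
            ((∑ m ∈ BFI.mRange M (M / 2), BFI.bump M (M / 2) m : ℝ) : ℂ) *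
              mainX1 a₁ a₂ ((BFI.mRange S Y).filter (fun q : ℕ => 0 < q)) (BFI.dyadic N)
                (fun q : ℕ => BFI.bump S Y q) β‖ ≤
          C * M * N ^ 2 * Real.log x ^ c₀ / Rd ^ 2 := by
  obtain ⟨ε₁, hε₁, HR⟩ := HR1
  intro η hη
  exact S1_of_R1_core hε₁ hη (HR η hη)

/-- **The `𝒮₁`-estimate from a bound for `ℛ₁^{≤H}`**, with the quantifier order the paper's
argument delivers (§5.5, p. 21: the saving coming from Theorem 2.1 is `x^{−η/2+O(δ)}`, so the
auxiliary exponents `ε₁` (frequency cut-off `H = ⌈(3S)²x^{ε₁}/M⌉`) and `δ` are chosen AFTER `η`):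
if for every `η > 0` there are `ε₁, δ > 0` with `|ℛ₁^{≤H}| ≤ C M N² (log x)^c / Rd²` in the range of
Theorem 5.1, then the hypothesis of `Drappeau2017_theorem51_of_S1` holds. [cite: Drappeau2017, §5.5] -/
theorem S1_of_R1'
    (HR1 : ∀ η : ℝ, 0 < η → ∃ ε₁ δ : ℝ, 0 < ε₁ ∧ 0 < δ ∧ ∀ Aτ : ℝ, 0 ≤ Aτ →
      ∃ C c₀ x₀ : ℝ, ∀ x : ℝ, x₀ ≤ x →
      ∀ M N S Rd Y : ℝ, M * N = x → x ^ η ≤ N → N ≤ S ^ (2 / 3 - η) → x ^ (1 / 4 : ℝ) ≤ S →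
        S ≤ x ^ (1 / 2 + δ) → 1 ≤ Rd → Rd ≤ x ^ δ → S * x ^ (-δ) ≤ Y → Y ≤ S / 4 →
      ∀ a₁ a₂ : ℤ, a₁ ≠ 0 → a₂ ≠ 0 → (|a₁| : ℝ) ≤ x ^ δ → (|a₂| : ℝ) ≤ x ^ δ →
      ∀ β : ℕ → ℂ, (∀ n, ‖β n‖ ≤ (σ 0 n : ℝ) ^ Aτ) → (∀ n, ¬Squarefree n → β n = 0) →
        ‖∑ q₁ ∈ ((BFI.mRange S Y).filter (fun q : ℕ => 0 < q)).filter
              (fun q : ℕ => IsCoprime (q : ℤ) (a₁ * a₂)),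
          ∑ q₂ ∈ ((BFI.mRange S Y).filter (fun q : ℕ => 0 < q)).filter
              (fun q : ℕ => IsCoprime (q : ℤ) (a₁ * a₂)),
            ((BFI.bump S Y q₁ : ℝ) : ℂ) * ((BFI.bump S Y q₂ : ℝ) : ℂ) *
            ∑ n₁ ∈ (BFI.dyadic N).filter (fun n : ℕ => IsCoprime (n : ℤ) a₂),
              ∑ n₂ ∈ (BFI.dyadic N).filter (fun n : ℕ => IsCoprime (n : ℤ) a₂),
                β n₁ * starRingEnd ℂ (β n₂) *
                ((M : ℂ) / (Nat.lcm q₁ q₂ : ℂ) *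
                  ∑ b ∈ (Finset.range (Nat.lcm q₁ q₂)).filter (fun b : ℕ =>
                      (b : ZMod q₁) * ((n₁ : ZMod q₁) * (a₂ : ZMod q₁)) = (a₁ : ZMod q₁) ∧
                      (b : ZMod q₂) * ((n₂ : ZMod q₂) * (a₂ : ZMod q₂)) = (a₁ : ZMod q₂)),
                    ∑ h ∈ Finset.Icc (-(⌈(3 * S) ^ 2 * x ^ ε₁ / M⌉₊ : ℤ)) ⌈(3 * S) ^ 2 * x ^ ε₁ / M⌉₊,
                      (if ((Nat.lcm q₁ q₂ : ℕ) : ℤ) ∣ h then 0 else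
                        𝓕 (BFI.bumpC 1 (1 / 2)) (M * h / (Nat.lcm q₁ q₂ : ℕ)) *
                          (𝐞 ((b : ℝ) * h / (Nat.lcm q₁ q₂ : ℕ)) : ℂ)))‖ ≤
          C * M * N ^ 2 * Real.log x ^ c₀ / Rd ^ 2) :
    ∀ η : ℝ, 0 < η → ∃ δ : ℝ, 0 < δ ∧ ∀ Aτ : ℝ, 0 ≤ Aτ → ∃ C c₀ x₀ : ℝ, ∀ x : ℝ, x₀ ≤ x →
      ∀ M N S Rd Y : ℝ, M * N = x → x ^ η ≤ N → N ≤ S ^ (2 / 3 - η) → x ^ (1 / 4 : ℝ) ≤ S →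
        S ≤ x ^ (1 / 2 + δ) → 1 ≤ Rd → Rd ≤ x ^ δ → S * x ^ (-δ) ≤ Y → Y ≤ S / 4 →
      ∀ a₁ a₂ : ℤ, a₁ ≠ 0 → a₂ ≠ 0 → (|a₁| : ℝ) ≤ x ^ δ → (|a₂| : ℝ) ≤ x ^ δ →
      ∀ β : ℕ → ℂ, (∀ n, ‖β n‖ ≤ (σ 0 n : ℝ) ^ Aτ) → (∀ n, ¬Squarefree n → β n = 0) →
        ‖dispS1 a₁ a₂ ((BFI.mRange S Y).filter (fun q : ℕ => 0 < q)) (BFI.mRange M (M / 2))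
              (BFI.dyadic N) (fun q : ℕ => BFI.bump S Y q) (fun m : ℕ => BFI.bump M (M / 2) m) β -
            ((∑ m ∈ BFI.mRange M (M / 2), BFI.bump M (M / 2) m : ℝ) : ℂ) *
              mainX1 a₁ a₂ ((BFI.mRange S Y).filter (fun q : ℕ => 0 < q)) (BFI.dyadic N)
                (fun q : ℕ => BFI.bump S Y q) β‖ ≤
          C * M * N ^ 2 * Real.log x ^ c₀ / Rd ^ 2 := by
  intro η hη
  obtain ⟨ε₁, δ, hε₁, hδ, H⟩ := HR1 η hη
  exact S1_of_R1_core hε₁ hη ⟨δ, hδ, H⟩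

end Drappeau2017

/-- **Drappeau 2017, Theorem 5.1 from a bound for the exponential sum `ℛ₁^{≤H}`.**  If for some
`ε₁ > 0` the truncated frequency sum `ℛ₁^{≤H}` (`H = ⌈(3S)² x^{ε₁}/M⌉`, see `Drappeau2017.S1_of_R1`)
satisfies `|ℛ₁^{≤H}| ≤ C M N² (log x)^c / Rd²` in the range of Theorem 5.1 (squarefree-supported `β`),
then Theorem 5.1 holds.  This isolates exactly the input that §5.4–5.5 of the paper draw from its
Theorem 2.1 (sums of Kloosterman sums in arithmetic progressions); everything else in §5
(§5.2, §5.3, Poisson summation, §5.6) is the tree's `Drappeau2017_theorem51_of_S1` and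
`Drappeau2017.S1_of_R1`. [cite: Drappeau2017, §5, Theorem 5.1] -/
theorem Drappeau2017_theorem51_of_R1
    (HR1 : ∃ ε₁ : ℝ, 0 < ε₁ ∧ ∀ η : ℝ, 0 < η → ∃ δ : ℝ, 0 < δ ∧ ∀ Aτ : ℝ, 0 ≤ Aτ →
      ∃ C c₀ x₀ : ℝ, ∀ x : ℝ, x₀ ≤ x →
      ∀ M N S Rd Y : ℝ, M * N = x → x ^ η ≤ N → N ≤ S ^ (2 / 3 - η) → x ^ (1 / 4 : ℝ) ≤ S →
        S ≤ x ^ (1 / 2 + δ) → 1 ≤ Rd → Rd ≤ x ^ δ → S * x ^ (-δ) ≤ Y → Y ≤ S / 4 →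
      ∀ a₁ a₂ : ℤ, a₁ ≠ 0 → a₂ ≠ 0 → (|a₁| : ℝ) ≤ x ^ δ → (|a₂| : ℝ) ≤ x ^ δ →
      ∀ β : ℕ → ℂ, (∀ n, ‖β n‖ ≤ (σ 0 n : ℝ) ^ Aτ) → (∀ n, ¬Squarefree n → β n = 0) →
        ‖∑ q₁ ∈ ((BFI.mRange S Y).filter (fun q : ℕ => 0 < q)).filter
              (fun q : ℕ => IsCoprime (q : ℤ) (a₁ * a₂)),
          ∑ q₂ ∈ ((BFI.mRange S Y).filter (fun q : ℕ => 0 < q)).filter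
              (fun q : ℕ => IsCoprime (q : ℤ) (a₁ * a₂)),
            ((BFI.bump S Y q₁ : ℝ) : ℂ) * ((BFI.bump S Y q₂ : ℝ) : ℂ) *
            ∑ n₁ ∈ (BFI.dyadic N).filter (fun n : ℕ => IsCoprime (n : ℤ) a₂),
              ∑ n₂ ∈ (BFI.dyadic N).filter (fun n : ℕ => IsCoprime (n : ℤ) a₂),
                β n₁ * starRingEnd ℂ (β n₂) *
                ((M : ℂ) / (Nat.lcm q₁ q₂ : ℂ) *
                  ∑ b ∈ (Finset.range (Nat.lcm q₁ q₂)).filter (fun b : ℕ =>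
                      (b : ZMod q₁) * ((n₁ : ZMod q₁) * (a₂ : ZMod q₁)) = (a₁ : ZMod q₁) ∧
                      (b : ZMod q₂) * ((n₂ : ZMod q₂) * (a₂ : ZMod q₂)) = (a₁ : ZMod q₂)),
                    ∑ h ∈ Finset.Icc (-(⌈(3 * S) ^ 2 * x ^ ε₁ / M⌉₊ : ℤ)) ⌈(3 * S) ^ 2 * x ^ ε₁ / M⌉₊,
                      (if ((Nat.lcm q₁ q₂ : ℕ) : ℤ) ∣ h then 0 else
                        𝓕 (BFI.bumpC 1 (1 / 2)) (M * h / (Nat.lcm q₁ q₂ : ℕ)) *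
                          (𝐞 ((b : ℝ) * h / (Nat.lcm q₁ q₂ : ℕ)) : ℂ)))‖ ≤
          C * M * N ^ 2 * Real.log x ^ c₀ / Rd ^ 2) :
    Drappeau2017_theorem51 :=
  Drappeau2017_theorem51_of_S1 (Drappeau2017.S1_of_R1 HR1)

/-- **Drappeau 2017, Theorem 5.1 from a bound for `ℛ₁^{≤H}`** — quantifier order as delivered by the
paper (`ε₁, δ` depending on `η`); see `Drappeau2017.S1_of_R1'`. [cite: Drappeau2017, §5, Theorem 5.1] -/
theorem Drappeau2017_theorem51_of_R1'
    (HR1 : ∀ η : ℝ, 0 < η → ∃ ε₁ δ : ℝ, 0 < ε₁ ∧ 0 < δ ∧ ∀ Aτ : ℝ, 0 ≤ Aτ →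
      ∃ C c₀ x₀ : ℝ, ∀ x : ℝ, x₀ ≤ x →
      ∀ M N S Rd Y : ℝ, M * N = x → x ^ η ≤ N → N ≤ S ^ (2 / 3 - η) → x ^ (1 / 4 : ℝ) ≤ S →
        S ≤ x ^ (1 / 2 + δ) → 1 ≤ Rd → Rd ≤ x ^ δ → S * x ^ (-δ) ≤ Y → Y ≤ S / 4 →
      ∀ a₁ a₂ : ℤ, a₁ ≠ 0 → a₂ ≠ 0 → (|a₁| : ℝ) ≤ x ^ δ → (|a₂| : ℝ) ≤ x ^ δ →
      ∀ β : ℕ → ℂ, (∀ n, ‖β n‖ ≤ (σ 0 n : ℝ) ^ Aτ) → (∀ n, ¬Squarefree n → β n = 0) →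
        ‖∑ q₁ ∈ ((BFI.mRange S Y).filter (fun q : ℕ => 0 < q)).filter
              (fun q : ℕ => IsCoprime (q : ℤ) (a₁ * a₂)),
          ∑ q₂ ∈ ((BFI.mRange S Y).filter (fun q : ℕ => 0 < q)).filter
              (fun q : ℕ => IsCoprime (q : ℤ) (a₁ * a₂)),
            ((BFI.bump S Y q₁ : ℝ) : ℂ) * ((BFI.bump S Y q₂ : ℝ) : ℂ) *
            ∑ n₁ ∈ (BFI.dyadic N).filter (fun n : ℕ => IsCoprime (n : ℤ) a₂),
              ∑ n₂ ∈ (BFI.dyadic N).filter (fun n : ℕ => IsCoprime (n : ℤ) a₂),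
                β n₁ * starRingEnd ℂ (β n₂) *
                ((M : ℂ) / (Nat.lcm q₁ q₂ : ℂ) *
                  ∑ b ∈ (Finset.range (Nat.lcm q₁ q₂)).filter (fun b : ℕ =>
                      (b : ZMod q₁) * ((n₁ : ZMod q₁) * (a₂ : ZMod q₁)) = (a₁ : ZMod q₁) ∧
                      (b : ZMod q₂) * ((n₂ : ZMod q₂) * (a₂ : ZMod q₂)) = (a₁ : ZMod q₂)),
                    ∑ h ∈ Finset.Icc (-(⌈(3 * S) ^ 2 * x ^ ε₁ / M⌉₊ : ℤ)) ⌈(3 * S) ^ 2 * x ^ ε₁ / M⌉₊,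
                      (if ((Nat.lcm q₁ q₂ : ℕ) : ℤ) ∣ h then 0 else
                        𝓕 (BFI.bumpC 1 (1 / 2)) (M * h / (Nat.lcm q₁ q₂ : ℕ)) *
                          (𝐞 ((b : ℝ) * h / (Nat.lcm q₁ q₂ : ℕ)) : ℂ)))‖ ≤
          C * M * N ^ 2 * Real.log x ^ c₀ / Rd ^ 2) :
    Drappeau2017_theorem51 :=
  Drappeau2017_theorem51_of_S1 (Drappeau2017.S1_of_R1' HR1)

end Literature.NumberTheory.Sieve

end
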